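import Literature.MathematicalPhysics.QuantumFieldTheory.Balaban1983to89.B9Thm310TransposedCommutatorB
import Literature.MathematicalPhysics.QuantumFieldTheory.Balaban1983to89.B9Thm310GTorusRegularCoverCubes

/-!
# `Balaban1983to89.B9Thm310TransposedCommutatorBMajorant` — T. Bałaban, *Propagators for lattice gauge theories in a background field*, Commun. Math. Phys.
# **99** (1985) 389–434 [Balaban1985BackgroundPropagators], Sect. C pp. 409–410, 413–416: the SCALE-WEIGHTED block majorant of the transposed commutator family
# `V_□ = −h_□G_□(U)K(h_□)(U)` of (3.105) read from the right ([4] (2.51), Prop. 2.2), summed over the cube cover of record, and Theorem 3.10 ⇒ Theorem 3.3 (3.42)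
# for `G(U) = Δ_a(U)⁻¹` with the FIRST family of the right remainder `hV` DISCHARGED (sub-row G-B9-LETTERS, module M5.7, PLAN item 5 «hV» family 1, file T3;
# the bond-sector twin of p21's `B9Thm37TransposedCommutatorMajorant`)

statement-level skeleton of published theorems with citation tags; proofs where landed; nothing here is a claim about the Yang–Mills mass gap

PDF held: `paper:balaban1985-cmp99-background-propagators` (journal page = PDF page + 388); pp. 397, 399, 409–410, 413–416 read from the held text layer;
[4] = [Balaban1984PropagatorsII] pp. 224, 232, 234–235.

THE PRINT.  p. 414 *«The operator K(h_□)G_□h_□ satisfies the inequality (3.89), hence it is small»*; p. 415 *«we use again the flexibility of these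
expansions»* (the expansion of `Δ_a⁻¹` from the right); p. 409 (3.89) *«|(K(h_□)G′_□h_□λ)(x)| ≦ O(M⁻¹)e^{−δ₀(Lʲη)⁻¹|y−y′|}|λ|»* (the cell's `O(1)(M⁻¹ + e^{−δ₀M})B₀e^{−δ₀d(y,y′)}` is our
reading of (3.89) with explicit constants), *«exactly the bound (2.44) of [4]»*; p. 410 l. 2–3 *«This theorem follows simply from Corollary 3.6 holding for all
G′_□, □ ∈ 𝒟, from the bound (3.89) and Lemma 2.1.»*; Thm 3.3 p. 399 with (3.42) p. 397; [4] (2.51) p. 232 *«A summation preserves it also»*, Prop. 2.2 (2.65)–(2.67) p. 234,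
(2.2) p. 224 with p. 235 (the window of `□⁺`), Lemma 2.1 (2.61) p. 234.

WHY THIS FILE (cell context).  M5.7's 6-B plug-in `B9Thm310GTorusRegularCoverCubes.eBlock_kernelFamilyBInv_GAY_of_coverCubes` displays `hV`, the scale-weighted
block majorant `θ_V·ℓ(a)ℓ(a′)⁻¹e^{−δ₀d(a,a′)}` of the four families of the transposed remainder; the first family is `−Σ_□ conj b (h_□G_□K(h_□))`.  From T2's
transposed (3.89) `‖h_□(b₋)·(G_□K(h_□)Λ)(b)‖ ≤ θ_Tᴮ·e^{−δ₀d(y,y′)}|J|` over the class (T1 = forms, T2 = sizes), §1 proves the INPUT LOCALITY of `K(h_□)` (its value at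
`b′` reads `Λ` two lattice steps around `b′` or on the double block of a bond averaging `b′` — the kernels of (3.100)–(3.104)), whence the window: the output block
`βa ∈ QT □` has level `≥ j − 1`, the input block has level `≤ j + 4`, so `ℓ(a)∕ℓ(a′) ≥ L⁻⁵`; §2 gives the per-cube majorant `1_{S′_□}(a)·M₂(Σ‖b_j‖)·θ_Tᴮ·L⁵·ℓ(a)ℓ(a′)⁻¹·
e^{−δ₀d(a,a′)}` on FILE 3-B's localisation sets and its sum over the cover (`N′ = 3·5^{d+1}e^{αδ₀(2L+6)}c₁(α)`); §3 plugs it into the 6-B plug-in: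
★★★ `eBlock_kernelFamilyBInv_GAY_of_coverCubes'` — the (3.42) block of `G(U)` at the cover of record with `hV` replaced by the majorant `hV′` of families 2–4 only
(`θ′_V`, still displayed: they are the walk re-expansion of p. 415 ∕ (3.101), PLAN items 6–7) and `θ_V := N′·M₂(Σ‖b_j‖)·θ_Tᴮ·L⁵ + θ′_V`, the radius-2 and radius-(2L+6)
neighbourhood counts discharged by [4] (2.61) (`card_ball_le_of_ineq261`).
HONEST SCOPE.  Displayed (by name): `hE` (Cor. 3.6 ∕ Thm 3.3 blocks of every cube letter), `hrest` and `hV′` (families 2–4), `hinvU`, `hinvC`, `ζ`, bi-contractivity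
`hU`∕`hT`, the plaquette datum `hW` (print's (3.35); `…DataOfPlaquettes.plaquetteDefect_of_reg335P`), `η = |c_f|⁻¹`, `0 ≤ b₁`, [4] Lemma 2.1 (`h261`, `h263`), the
two smallness conditions.  Nothing continuum ∕ OS ∕ mass gap ∕ Clay; YM mass gap NOT proved by any of this (Track A conditional rung).  `--supports stmt-QuantumFields-19200`.
WHAT IS PROVED (all `theorem`s, 0 `def`, 0 sorry).  §1 `KhBY_apply_eq_zero_of_input`, `exists_input_of_KhBY_ne_zero`, `one_le_pow_mul_len_ratio`;
§2 ★★ `hasMajorant_conj_transposedCommB`, `sum_transposedCommB_majorant_le`, ★★ `hasMajorant_sum_conj_transposedCommB`; §3 ★★★ `eBlock_kernelFamilyBInv_GAY_of_coverCubes'`.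
Net new unproved facts: 0.
-/

noncomputable section

namespace Literature.MathematicalPhysics.QuantumFieldTheory.Balaban1983to89.B9Thm310TransposedCommutatorBMajorant

open Node00 B9CubeLettersInvReadings
open B9Thm310TransposedCommutatorB (norm_hTY_O_KhBY_apply_le card_ball_le_of_ineq261 avg_apply_eq_zero_of)
open B9Thm37CubeCoverCommutators (cutMulY cutMulY_apply hTY)
open B9Thm37CubeCoverCommutatorSizes (side_conditions four_le_P')
open B9Thm37CommutatorBound389 (lev_le_succ_of_touch lev_le_succ_of_touch' torusSupNorm_sub_shiftY_le_one geo9K_len_eq levY_eq_lvl_of_blkOf_eq)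
open B9Thm37TransposedCommutator (lvl_ge_of_mem_QT)
open B9Eq3104CutoffCommutators
open B9Eq3104CommutatorSupport (trLiftY_apply_eq_zero_of jordanY_apply_eq_zero_of touch_symm touch_of_gradK_ne_zero touch_src_of_curlK_ne_zero
  touch_plaq_of_curlK_ne_zero touch_src_edgeY qwt_ne_zero_of_qsK_ne_zero qwt_ne_zero_of_qK_ne_zero levY_src_bounds_of_qwt_ne_zero
  levY_src_le_of_KhBY_hTY_ne_zero)
open B9Eq3104CommutatorSizesLoc (norm_cutCommR_curv2Y_hTY_apply_le_loc)
open B9Thm310CommutatorBound389B (abs_le_supNorm_inr step_facts two_step_facts b1_pos theta389B)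
open B9Thm310CommutatorBound389BMajorant (hasMajorant_conj_of_ball_boundB norm_liftY_le_abs)
open B9CubeLettersInvReadDictB (h342₀_of_eBlockInvB h342₂_of_eBlockInvB)
open B9Thm310CommutatorDataOfPlaquettes (bicontr_holY)
open B9Thm310CutoffDivTermsB (sum_indicator_const_le)
open B9Thm310GTorusRegularCoverCubes (eBlock_kernelFamilyBInv_GAY_of_coverCubes)
open B9CubeLettersBondOpsL0 (deltaACubeY GACubeY)
open B9Eq3105AtLetters (DPDsCubeY P1CubeY)
open B6KLevelCensusIndexV1 (KIdx)
open B6Ineq2142KLevelV1 (β lvl beta_level)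
open B6GlobalChartV1 (blkV1)
open B4TorusKernel.MultiPeriod (torusSupNorm)
open B6Geom246MultiLevelBox (bset blkOf)
open B6Geom246MultiLevelTorus (bondT)
open B6Cover236MultiLevelBlocks (cubes)
open B6Partition118KLevelTorusCentral (QT blkOf_mem_QT_of_hT_ne_zero)
open B6Partition118KLevelFineSizes (C1F C1F_nonneg)
open B6Partition118KLevelFineSecond (C2F C2F_nonneg)
open B6Partition118KLevelFineMixed (C2X C2X_bounds)
open B6Partition118KLevelTorusBinders (sLipT sLipT_nonneg)
open B6RandomWalk (HasMajorant Ineq261 Ineq263 hasMajorant_mono hasMajorant_add c1_nonneg)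
open B9Thm34Ext (toB6)
open B9FromB6 (EBlock)
open B9GeoNormsKLevelV1 (geo9K geo9K_supNorm_nonneg)
open B9Eq352DivFormLetters (conj)
open B9Ineq349SiteComposite (etaS_pos)
open Node00.OpsYNablaBridge (chartY divK_apply)
open scoped Matrix

variable {d ℓ : ℕ} {hd : 1 ≤ d + 1} {hL : Odd (ℓ + 1) ∧ 1 < ℓ + 1} {b₀ b₁ : ℝ}
variable {𝔸 : Type} [NormedRing 𝔸] [NormedAlgebra ℂ 𝔸] [CompleteSpace 𝔸]
variable {ι : Type} [Fintype ι] [DecidableEq ι]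
variable (i : KIdx d ℓ hd hL b₀ b₁) (b : Module.Basis ι ℝ 𝔸)

/-! ## §1 The input locality of `K(h_□)(U)` (the kernels of (3.100)–(3.104)) and the window of the scale weight -/

section Locality

omit [CompleteSpace 𝔸] [Fintype ι] [DecidableEq ι] in
/-- a kernel commutator vanishes at `y` when the input vanishes on the row support of `y`. [cite: Balaban1985BackgroundPropagators, (3.102) p.414, bookkeeping] -/
theorem cutCommR_trLiftY_apply_eq_zero_of_val {X Y : Type} [Fintype X] [Fintype Y] (hY : Y → ℝ) (hX : X → ℝ) (M : Matrix Y X ℝ)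
    (T : Y → X → 𝔸ˣ) (Λ : X → 𝔸) (y : Y) (h : ∀ x, M y x ≠ 0 → Λ x = 0) : cutCommR hY hX (trLiftY M T) Λ y = 0 := by
  rw [cutCommR_trLiftY]
  refine trLiftY_apply_eq_zero_of _ _ Λ y fun x hx => h x ?_
  rw [Matrix.of_apply] at hx
  exact left_ne_zero_of_mul hx

omit [Fintype ι] [DecidableEq ι] in
/-- ★ **THE INPUT LOCALITY OF `K(h_□)(U)`**: if `Λ` vanishes at every bond two lattice steps around `chart b₋` and at every fine bond averaged by a coarse bond averaging `b`,
then `(K(h_□)(U)Λ)(b) = 0` — the seven summands of `KhBY_eq_sum` read `Λ` through the kernels `∂*∂`, `Δ′₂`, `∂∂*`, `Q*aQ` of (3.100)–(3.104), whose row supports are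
these. [cite: Balaban1985BackgroundPropagators, (3.100)–(3.104) pp.413–414, (3.10) p.392, (3.4) p.391, (3.8) p.392] -/
theorem KhBY_apply_eq_zero_of_input (c : ↥(cubes i.D.toDomains)) (parB : BondParY 𝔸 i) (U : CfgY 𝔸 i)
    (hU : ∀ μ x, ‖(U μ x : 𝔸)‖ ≤ 1 ∧ ‖(((U μ x)⁻¹ : 𝔸ˣ) : 𝔸)‖ ≤ 1) (A : FBondY i → 𝔸) (b : FBondY i)
    (h1 : ∀ (f : FBondY i) (u₁ : SiteY i), torusSupNorm (toKT i).NB ((chartY i b.src).1 - u₁.1) ≤ 1 →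
      torusSupNorm (toKT i).NB (u₁.1 - (chartY i f.src).1) ≤ 1 → A f = 0)
    (h2 : ∀ (y : IBondY i) (f : FBondY i), qsK i b y ≠ 0 → qK i y f ≠ 0 → A f = 0) :
    KhBY i (hTY i c) parB U A b = 0 := by
  set h : SiteY i → ℝ := hTY i c with hh
  -- the curl reads `A` on the contour of a plaquette through `b`
  have hcurl : ∀ p : PlaqY i, curlK i p b ≠ 0 → curlY i U A p = 0 := fun p hp =>
    trLiftY_apply_eq_zero_of (curlK i) _ A p fun f hf => h1 f (chartY i p.src) (touch_plaq_of_curlK_ne_zero i hp) (touch_src_of_curlK_ne_zero i hf)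
  -- (1) `[h_B | h_P] coCurl ∘ 𝒥 ∘ curl`
  have e1 : cutCommR (hBdY i h) (hPlY i h) (coCurlY i U) (jordanY i U (curlY i U A)) b = 0 := by
    refine cutCommR_trLiftY_apply_eq_zero_of_val (hBdY i h) (hPlY i h) (cocurlK i) _ _ b fun p hp => jordanY_apply_eq_zero_of i U (hcurl p ?_)
    rwa [cocurlK_eq_transpose, Matrix.transpose_apply] at hp
  -- (2) `coCurl ∘ 𝒥 ∘ [h_P | h_B] curl`
  have e2 : coCurlY i U (jordanY i U (cutCommR (hPlY i h) (hBdY i h) (curlY i U) A)) b = 0 := by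
    refine trLiftY_apply_eq_zero_of (cocurlK i) _ _ b fun p hp => jordanY_apply_eq_zero_of i U ?_
    have hp' : curlK i p b ≠ 0 := by rwa [cocurlK_eq_transpose, Matrix.transpose_apply] at hp
    exact cutCommR_trLiftY_apply_eq_zero_of_val (hPlY i h) (hBdY i h) (curlK i) _ A p fun f hf =>
      h1 f (chartY i p.src) (touch_plaq_of_curlK_ne_zero i hp') (touch_src_of_curlK_ne_zero i hf)
  -- (3) `[h_B] Δ′₂`: E′₁-loc's bound with `G₀ = 0`
  have e3 : cutCommR (hBdY i h) (hBdY i h) (curv2Y i U) A b = 0 := by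
    have hA : ∀ (p : PlaqY i) (m l : Fin 4), edgeY i p m = b → ‖A (edgeY i p l)‖ ≤ 0 := by
      intro p m l hm
      have t₁ : torusSupNorm (toKT i).NB ((chartY i b.src).1 - (chartY i p.src).1) ≤ 1 := by
        rw [← hm]; exact touch_symm i (touch_src_edgeY i p m)
      rw [h1 (edgeY i p l) (chartY i p.src) t₁ (touch_src_edgeY i p l), norm_zero]
    have hI : ∀ (p : PlaqY i) (m : Fin 4), edgeY i p m = b → ‖((i.cf ^ 2 : ℝ) : ℂ) • imHolY i U p‖ ≤ i.cf ^ 2 * 2 := by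
      intro p m _
      have hb := bicontr_holY i U hU p
      rw [norm_smul, Complex.norm_real, Real.norm_eq_abs, abs_of_nonneg (sq_nonneg _)]
      refine mul_le_mul_of_nonneg_left ?_ (sq_nonneg _)
      unfold imHolY
      rw [norm_smul]
      have hn : ‖(-Complex.I / 2 : ℂ)‖ = 1 / 2 := by simp
      have := norm_sub_le ((holY i U p : 𝔸ˣ) : 𝔸) (((holY i U p)⁻¹ : 𝔸ˣ) : 𝔸)
      nlinarith [hb.1, hb.2, norm_nonneg (-Complex.I / 2 : ℂ), hn]
    have key := norm_cutCommR_curv2Y_hTY_apply_le_loc i c U hU (by positivity : (0 : ℝ) ≤ i.cf ^ 2 * 2) A b hI le_rfl hA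
    rw [mul_zero] at key
    exact norm_le_zero_iff.1 key
  -- the divergence reads `A` one step from its site
  have hdiv : ∀ z : SiteY i, torusSupNorm (toKT i).NB ((chartY i b.src).1 - z.1) ≤ 1 → divY i U A z = 0 := fun z hz =>
    trLiftY_apply_eq_zero_of (divK i) _ A z fun f hf => h1 f z hz (by rw [divK_apply] at hf; exact touch_symm i (touch_of_gradK_ne_zero i hf))
  -- (4) `[h_B | h] D ∘ D*`
  have e4 : cutCommR (hBdY i h) h (gradY i U) (divY i U A) b = 0 :=
    cutCommR_trLiftY_apply_eq_zero_of_val (hBdY i h) h (gradK i) _ _ b fun z hz => hdiv z (touch_of_gradK_ne_zero i hz)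
  -- (5) `D ∘ [h | h_B] D*`
  have e5 : gradY i U (cutCommR h (hBdY i h) (divY i U) A) b = 0 := by
    refine trLiftY_apply_eq_zero_of (gradK i) _ _ b fun z hz => ?_
    exact cutCommR_trLiftY_apply_eq_zero_of_val h (hBdY i h) (divK i) _ A z fun f hf =>
      h1 f z (touch_of_gradK_ne_zero i hz) (by rw [divK_apply] at hf; exact touch_symm i (touch_of_gradK_ne_zero i hf))
  -- (6), (7) the averaging
  have hQ : ∀ y : IBondY i, qsK i b y ≠ 0 → QY i parB U A y = 0 := fun y hy =>
    trLiftY_apply_eq_zero_of (qK i) (qT i parB U) A y fun f hf => h2 y f hy hf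
  have e6 : cutCommR (hBdY i h) (hIbY i h) (QsY i parB U) (aY i (QY i parB U A)) b = 0 :=
    cutCommR_trLiftY_apply_eq_zero_of_val (hBdY i h) (hIbY i h) (qsK i) _ _ b fun y hy =>
      B9Eq3104CommutatorSupport.aY_apply_eq_zero_of i (hQ y hy)
  have e7 : QsY i parB U (aY i (cutCommR (hIbY i h) (hBdY i h) (QY i parB U) A)) b = 0 := by
    refine trLiftY_apply_eq_zero_of (qsK i) _ _ b fun y hy => B9Eq3104CommutatorSupport.aY_apply_eq_zero_of i ?_
    exact cutCommR_trLiftY_apply_eq_zero_of_val (hIbY i h) (hBdY i h) (qK i) _ A y fun f hf => h2 y f hy hf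
  rw [KhBY_eq_sum]
  simp only [LinearMap.add_apply, Pi.add_apply, LinearMap.comp_apply]
  rw [e1, e2, e3, e4, e5, e6, e7]
  simp

omit [Fintype ι] [DecidableEq ι] in
/-- ★ **THE INPUT ALTERNATIVE WITH LEVELS**: where `(K(h_□)(U)Λ)(b) ≠ 0`, `Λ ≠ 0` at some bond `f` with `lev f ≤ lev b + 2` (two lattice steps, or the double block
of a bond averaging `b`, [4] (2.2)–(2.4)). [cite: Balaban1985BackgroundPropagators, (3.100)–(3.104) pp.413–414; Balaban1984PropagatorsII, (2.2)–(2.4) p.224] -/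
theorem exists_input_of_KhBY_ne_zero (c : ↥(cubes i.D.toDomains)) (parB : BondParY 𝔸 i) (U : CfgY 𝔸 i)
    (hU : ∀ μ x, ‖(U μ x : 𝔸)‖ ≤ 1 ∧ ‖(((U μ x)⁻¹ : 𝔸ˣ) : 𝔸)‖ ≤ 1) (A : FBondY i → 𝔸) (b : FBondY i)
    (hK : KhBY i (hTY i c) parB U A b ≠ 0) :
    ∃ f : FBondY i, A f ≠ 0 ∧ levY i (chartY i f.src) ≤ levY i (chartY i b.src) + 2 := by
  by_contra H
  push Not at H
  refine hK (KhBY_apply_eq_zero_of_input i c parB U hU A b (fun f u₁ h01 h1f => ?_) (fun y f hy hf => ?_))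
  · by_contra hA
    have := H f hA
    have := (two_step_facts i h01 h1f).2
    omega
  · by_contra hA
    have := H f hA
    have hb := levY_src_bounds_of_qwt_ne_zero i (qwt_ne_zero_of_qsK_ne_zero i hy)
    have hf' := levY_src_bounds_of_qwt_ne_zero i (qwt_ne_zero_of_qK_ne_zero i hf)
    omega

omit [NormedRing 𝔸] [NormedAlgebra ℂ 𝔸] [CompleteSpace 𝔸] [Fintype ι] [DecidableEq ι] in
/-- **THE SCALE WEIGHT ACROSS THE WINDOW**: if `lvl(a′) ≤ lvl(a) + n` then `1 ≤ Lⁿ·ℓ(a)·ℓ(a′)⁻¹` (`ℓ = L^{lvl}·|c_f|⁻¹`).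
[cite: Balaban1984PropagatorsII, (2.1) p.224, (2.2) p.224, bookkeeping] -/
theorem one_le_pow_mul_len_ratio (hη : etaS i = |i.cf|⁻¹) {a a' : IBondY i} {n : ℕ}
    (h : lvl i.hN i.D i.hk a' ≤ lvl i.hN i.D i.hk a + n) :
    1 ≤ ((ℓ : ℝ) + 1) ^ n * (geo9K i).len a * ((geo9K i).len a')⁻¹ := by
  have hL1 : (1 : ℝ) ≤ (ℓ : ℝ) + 1 := by linarith [(Nat.cast_nonneg ℓ : (0 : ℝ) ≤ ℓ)]
  have hcf : 0 < |i.cf| := by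
    have h0 : 0 < |i.cf|⁻¹ := by rw [← hη]; exact etaS_pos i
    exact inv_pos.mp h0
  have hla' : 0 < (geo9K i).len a' := B6KLevelCensusIndexV1.len_pos i a'
  rw [mul_assoc, ← div_eq_mul_inv, ← mul_div_assoc, one_le_div₀ hla', geo9K_len_eq, geo9K_len_eq]
  push_cast
  rw [mul_div_assoc', div_le_div_iff_of_pos_right hcf, ← pow_add]
  exact pow_le_pow_right₀ hL1 (by omega)

end Locality

/-! ## §2 The scale-weighted block majorant of `conj b (h_□G_□K(h_□))`, per cube and summed over the cover -/

section Majorant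

variable [Fintype (geo9K i).Site] {Rr : ℝ} {Hp : Prop}
variable (ιB : BlkY i → IBondY i)
variable {B : B9.Backgrounds} (cfg : B.Cfg → CfgY 𝔸 i) (par : BondParY 𝔸 i) {U₁ : B.Cfg}

omit [DecidableEq ι] in
/-- ★★ **THE SCALE-WEIGHTED BLOCK MAJORANT OF ONE TRANSPOSED COMMUTATOR TERM `conj b (h_□G_□(U)K(h_□)(U))` FROM THE CUBE LETTER'S (3.42) BLOCK OVER THE
CLASS**: on FILE 3-B's localisation set `S′_□ = {a : ∃ y ∈ QT □, d_T(βa, y) ≤ 2L+6}` (the term carries the outer `h_□(b₋)`, so `Δ(b) ∈ QT □`),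
`1_{S′_□}(a)·M₂(Σ‖b_j‖)·θ_Tᴮ·L⁵·ℓ(a)·ℓ(a′)⁻¹·e^{−δ₀d(a,a′)}`, with T2's `θ_Tᴮ` (written out; radius-2 count `m₂`, radius-(2L+6) count `m_Q`): the output block has
level `≥ j − 1` and, by the input locality of `K(h_□)` (§1) and its level window (`lev b″ ≤ j + 2`), the input block has level `≤ j + 4`, so `1 ≤ L⁵ℓ(a)∕ℓ(a′)`.
[cite: Balaban1985BackgroundPropagators, p.414 («K(h_□)G_□h_□ satisfies (3.89)»), (3.89) p.409, Thm 3.3 (3.42) p.397; Balaban1984PropagatorsII, (2.51) p.232, (2.2) p.224, p.235] -/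
theorem hasMajorant_conj_transposedCommB (hι : ∀ s, β i.hN i.D i.hk (ιB s) = s)
    {M₂ : ℝ} (hM₂ : 0 ≤ M₂) (hrepr : ∀ (v : 𝔸) (j : ι), |b.repr v j| ≤ M₂ * ‖v‖) (hη : etaS i = |i.cf|⁻¹)
    (parS : SiteParY 𝔸 i) (parB : BondParY 𝔸 i) {B₀ δ₀ : ℝ} (hB₀ : 0 ≤ B₀) (hδ₀ : 0 ≤ δ₀)
    (c : ↥(cubes i.D.toDomains)) (hE : EBlock (kernelFamilyBInv i B cfg (GACubeY i c parS parB) par) B₀ δ₀ U₁)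
    (hU : ∀ μ x, ‖(cfg U₁ μ x : 𝔸)‖ ≤ 1 ∧ ‖(((cfg U₁ μ x)⁻¹ : 𝔸ˣ) : 𝔸)‖ ≤ 1)
    (hT : ∀ (y : IBondY i) (f : FBondY i), ‖(qT i parB (cfg U₁) y f : 𝔸)‖ ≤ 1 ∧ ‖(((qT i parB (cfg U₁) y f)⁻¹ : 𝔸ˣ) : 𝔸)‖ ≤ 1)
    {δh : ℝ} (hδh : 0 ≤ δh)
    (hW : ∀ p : PlaqY i, ‖((holY i (cfg U₁) p : 𝔸ˣ) : 𝔸) - 1‖ ≤ δh * ((((ℓ : ℝ) + 1) ^ levY i (chartY i p.src))⁻¹) ^ 2)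
    (T₂ : IBondY i → Finset (IBondY i)) (hT₂ : ∀ a y' : IBondY i, (geo9K i).dist a y' ≤ 2 → a ∈ T₂ y')
    {m₂ : ℝ} (hm₂ : 0 ≤ m₂) (hnbr₂ : ∀ y' : IBondY i, ((T₂ y').card : ℝ) ≤ m₂)
    (TQ : IBondY i → Finset (IBondY i)) (hTQ : ∀ a y' : IBondY i, (geo9K i).dist a y' ≤ 2 * (ℓ : ℝ) + 6 → a ∈ TQ y')
    {mQ : ℝ} (hmQ : 0 ≤ mQ) (hnbrQ : ∀ y' : IBondY i, ((TQ y').card : ℝ) ≤ mQ) :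
    HasMajorant (g := toB6 (geo9K i) Rr Hp) (fun p : FBondY i × ι => ιB (blkV1 i.hN i.D p.1))
      (conj b ((cutMulY (hBdY i (hTY i c)) * GACubeY i c parS parB (cfg U₁) * KhBY i (hTY i c) parB (cfg U₁)).restrictScalars ℝ))
      (fun a a' => if (∃ y ∈ QT i.D (B9GeoLemma21KLevelV1.one_le_Mh i) (four_le_P' i) c,
          (((bondT i.D).dist (β i.hN i.D i.hk a) y : ℕ) : ℝ) ≤ 2 * (ℓ : ℝ) + 6)
        then M₂ * (∑ j, ‖b j‖) *
          ((B₀ * (((d : ℝ) + 1) * m₂ * Real.exp (δ₀ * 2)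
              * ((2 * ((d : ℝ) + 1) + 4) * (5 / 8 * C1F d ℓ / i.Mh) + (5 / 8) ^ 2 * (C2F d ℓ + 2 * C2X d ℓ) / (i.Mh : ℝ) ^ 2
                  + 8 * δh * ((ℓ : ℝ) + 1) ^ 5 * (5 / 8 * C1F d ℓ / i.Mh) + 64 * δh * ((ℓ : ℝ) + 1) ^ 7 * (5 / 8 * C1F d ℓ / i.Mh))
            + mQ * Real.exp (δ₀ * (2 * (ℓ : ℝ) + 6))
              * (4 * b₁ * ((ℓ : ℝ) + 1) ^ 6 * (((ℓ : ℝ) + 1) ^ (d + 1)) ^ 5 * (sLipT d ℓ / (((ℓ : ℝ) + 1) * i.Mh) * (((ℓ : ℝ) + 1) + 3)))))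
            * ((ℓ : ℝ) + 1) ^ 5) *
          ((geo9K i).len a * ((geo9K i).len a')⁻¹) * Real.exp (-(δ₀ * (geo9K i).dist a a'))
        else 0) := by
  classical
  obtain ⟨_, hMh2, hR2, _⟩ := side_conditions i
  have hM : (0 : ℝ) < i.Mh := by exact_mod_cast (lt_of_lt_of_le (by norm_num) hMh2)
  have hC1 : 0 ≤ C1F d ℓ := C1F_nonneg d ℓ
  have hC2 : 0 ≤ C2F d ℓ := C2F_nonneg d ℓ
  have hC2X : 0 ≤ C2X d ℓ := (C2X_bounds d ℓ).2.2
  have hsL : 0 ≤ sLipT d ℓ := sLipT_nonneg d ℓ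
  set U : CfgY 𝔸 i := cfg U₁ with hUdef
  set O := GACubeY i c parS parB U with hOdef
  set θT : ℝ := B₀ * (((d : ℝ) + 1) * m₂ * Real.exp (δ₀ * 2)
      * ((2 * ((d : ℝ) + 1) + 4) * (5 / 8 * C1F d ℓ / i.Mh) + (5 / 8) ^ 2 * (C2F d ℓ + 2 * C2X d ℓ) / (i.Mh : ℝ) ^ 2
          + 8 * δh * ((ℓ : ℝ) + 1) ^ 5 * (5 / 8 * C1F d ℓ / i.Mh) + 64 * δh * ((ℓ : ℝ) + 1) ^ 7 * (5 / 8 * C1F d ℓ / i.Mh))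
    + mQ * Real.exp (δ₀ * (2 * (ℓ : ℝ) + 6))
      * (4 * b₁ * ((ℓ : ℝ) + 1) ^ 6 * (((ℓ : ℝ) + 1) ^ (d + 1)) ^ 5 * (sLipT d ℓ / (((ℓ : ℝ) + 1) * i.Mh) * (((ℓ : ℝ) + 1) + 3)))) with hθT
  have hb1 : ∀ a : IBondY i, 0 ≤ b₁ := fun a => (b1_pos i a).le
  -- the operator as ONE ℝ-linear letter, ℂ-homogeneous
  set Rl : Module.End ℝ (FBondY i → 𝔸) :=
    (cutMulY (hBdY i (hTY i c)) * GACubeY i c parS parB (cfg U₁) * KhBY i (hTY i c) parB (cfg U₁)).restrictScalars ℝ with hRl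
  have hRl_apply : ∀ Λ, Rl Λ = cutMulY (hBdY i (hTY i c)) (O (KhBY i (hTY i c) parB U Λ)) := fun Λ => rfl
  have hTc : ∀ (cx : ℂ) (Λ : FBondY i → 𝔸), Rl (cx • Λ) = cx • Rl Λ := fun cx Λ => by
    rw [hRl, LinearMap.restrictScalars_apply, LinearMap.restrictScalars_apply, map_smul]
  have hlen0 : ∀ a : IBondY i, 0 ≤ (geo9K i).len a := fun a => (B6KLevelCensusIndexV1.len_pos i a).le
  have hW0 : ∀ a a' : IBondY i, 0 ≤ (if (∃ y ∈ QT i.D (B9GeoLemma21KLevelV1.one_le_Mh i) (four_le_P' i) c,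
        (((bondT i.D).dist (β i.hN i.D i.hk a) y : ℕ) : ℝ) ≤ 2 * (ℓ : ℝ) + 6)
      then θT * ((ℓ : ℝ) + 1) ^ 5 * ((geo9K i).len a * ((geo9K i).len a')⁻¹) * Real.exp (-(δ₀ * (geo9K i).dist a a')) else 0) := by
    intro a a'
    have := hb1 a
    split_ifs
    · exact mul_nonneg (mul_nonneg (by positivity) (mul_nonneg (hlen0 a) (inv_nonneg.2 (hlen0 a')))) (Real.exp_pos _).le
    · exact le_rfl
  have h342₀ := h342₀_of_eBlockInvB i b cfg (GACubeY i c parS parB) par hE hM₂ hrepr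
  have h342₂ := h342₂_of_eBlockInvB i b cfg (GACubeY i c parS parB) par hE hM₂ hrepr
  have hTW : ∀ (J : FBondY i → ℝ) (y y' : IBondY i), (geo9K i).suppIn (Sum.inr J) y' → ∀ E : 𝔸, ‖E‖ ≤ 1 →
      ∀ x : FBondY i, blkV1 i.hN i.D x = β i.hN i.D i.hk y → ‖Rl (liftY J E) x‖
        ≤ (if (∃ yq ∈ QT i.D (B9GeoLemma21KLevelV1.one_le_Mh i) (four_le_P' i) c,
              (((bondT i.D).dist (β i.hN i.D i.hk y) yq : ℕ) : ℝ) ≤ 2 * (ℓ : ℝ) + 6)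
            then θT * ((ℓ : ℝ) + 1) ^ 5 * ((geo9K i).len y * ((geo9K i).len y')⁻¹) * Real.exp (-(δ₀ * (geo9K i).dist y y')) else 0)
          * (geo9K i).supNorm (Sum.inr J) := by
    intro J y y' hs E hE x hx
    have hS0 : 0 ≤ (geo9K i).supNorm (Sum.inr J) := geo9K_supNorm_nonneg i _
    rw [hRl_apply]
    by_cases h0 : cutMulY (hBdY i (hTY i c)) (O (KhBY i (hTY i c) parB U (liftY J E))) x = 0
    · rw [h0, norm_zero]; exact mul_nonneg (hW0 y y') hS0
    -- the term is non-zero: `h_□(x₋) ≠ 0`, so `Δ(x) = βy ∈ QT □` (level `≥ j − 1`) …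
    have hx0 : hTY i c (chartY i x.src) ≠ 0 := by
      intro hz; apply h0; rw [cutMulY_apply, hBdY_apply, hz, Complex.ofReal_zero, zero_smul]
    have hQT : blkOf i.D.toDomains (chartY i x.src) ∈ QT i.D (B9GeoLemma21KLevelV1.one_le_Mh i) (four_le_P' i) c :=
      blkOf_mem_QT_of_hT_ne_zero hMh2 hR2 (four_le_P' i) c hx0
    have hQTy : β i.hN i.D i.hk y ∈ QT i.D (B9GeoLemma21KLevelV1.one_le_Mh i) (four_le_P' i) c := by rw [← hx]; exact hQT
    have hmem : ∃ yq ∈ QT i.D (B9GeoLemma21KLevelV1.one_le_Mh i) (four_le_P' i) c,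
        (((bondT i.D).dist (β i.hN i.D i.hk y) yq : ℕ) : ℝ) ≤ 2 * (ℓ : ℝ) + 6 := by
      refine ⟨β i.hN i.D i.hk y, hQTy, ?_⟩
      rw [SimpleGraph.dist_self, Nat.cast_zero]; positivity
    have hlo : c.1.1 ≤ lvl i.hN i.D i.hk y + 1 := by
      have h := lvl_ge_of_mem_QT i c hQTy
      rwa [beta_level i.hN i.D i.hk (le_trans one_le_two i.hk2)] at h
    -- … and `K(h_□)Λ ≠ 0` somewhere, so the input block has level `≤ j + 4`
    have hK : KhBY i (hTY i c) parB U (liftY J E) ≠ 0 := by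
      intro hz; apply h0; rw [hz, map_zero, cutMulY_apply, Pi.zero_apply, smul_zero]
    obtain ⟨b'', hb''⟩ := Function.ne_iff.1 hK
    have hlev'' : levY i (chartY i b''.src) ≤ c.1.1 + 2 := levY_src_le_of_KhBY_hTY_ne_zero i c parB U (liftY J E) b'' hb''
    obtain ⟨f, hf, hlevf⟩ := exists_input_of_KhBY_ne_zero i c parB U hU (liftY J E) b'' hb''
    have hJf : J f ≠ 0 := by
      intro hJ0; apply hf; rw [liftY_apply, hJ0, Complex.ofReal_zero, zero_smul]
    have hblkf : blkV1 i.hN i.D f = β i.hN i.D i.hk y' := hs f hJf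
    have hlvly' : levY i (chartY i f.src) = lvl i.hN i.D i.hk y' := levY_eq_lvl_of_blkOf_eq i hblkf
    have hwin : lvl i.hN i.D i.hk y' ≤ lvl i.hN i.D i.hk y + 5 := by omega
    have hratio : 1 ≤ ((ℓ : ℝ) + 1) ^ 5 * (geo9K i).len y * ((geo9K i).len y')⁻¹ := one_le_pow_mul_len_ratio i hη hwin
    rw [if_pos hmem]
    have hmain := norm_hTY_O_KhBY_apply_le i c parB U O hB₀ hδ₀ hη ιB hι hU hT hδh hW h342₀ h342₂ T₂ hT₂ hm₂ hnbr₂ TQ hTQ hmQ hnbrQ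
      J y y' hs (liftY J E) (norm_liftY_le_abs i J hE) x hx
    have hb1y := hb1 y
    have hθT0 : 0 ≤ θT := by positivity
    have hP0 : 0 ≤ θT * Real.exp (-(δ₀ * (geo9K i).dist y y')) * (geo9K i).supNorm (Sum.inr J) := by positivity
    refine hmain.trans ?_
    calc θT * Real.exp (-(δ₀ * (geo9K i).dist y y')) * (geo9K i).supNorm (Sum.inr J)
        = 1 * (θT * Real.exp (-(δ₀ * (geo9K i).dist y y')) * (geo9K i).supNorm (Sum.inr J)) := (one_mul _).symm
      _ ≤ (((ℓ : ℝ) + 1) ^ 5 * (geo9K i).len y * ((geo9K i).len y')⁻¹) *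
            (θT * Real.exp (-(δ₀ * (geo9K i).dist y y')) * (geo9K i).supNorm (Sum.inr J)) := mul_le_mul_of_nonneg_right hratio hP0
      _ = _ := by ring
  have h := hasMajorant_conj_of_ball_boundB (Rr := Rr) (Hp := Hp) i b Rl hTc ιB hι hM₂ hrepr _ hW0 hTW
  refine hasMajorant_mono (g := toB6 (geo9K i) Rr Hp) _ h fun a a' => le_of_eq ?_
  show M₂ * (∑ j, ‖b j‖) * (if (∃ y ∈ QT i.D (B9GeoLemma21KLevelV1.one_le_Mh i) (four_le_P' i) c,
        (((bondT i.D).dist (β i.hN i.D i.hk a) y : ℕ) : ℝ) ≤ 2 * (ℓ : ℝ) + 6)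
      then θT * ((ℓ : ℝ) + 1) ^ 5 * ((geo9K i).len a * ((geo9K i).len a')⁻¹) * Real.exp (-(δ₀ * (geo9K i).dist a a')) else 0) = _
  split_ifs
  · ring
  · rw [mul_zero]

omit [CompleteSpace 𝔸] [NormedAlgebra ℂ 𝔸] in
/-- ★ **THE SUM OVER THE COVER OF THE PER-CUBE MAJORANTS**: `Σ_□ 1_{S′_□}(a)·K·ℓ(a)ℓ(a′)⁻¹e^{−δ₀d(a,a′)} ≤ N′·K·ℓ(a)ℓ(a′)⁻¹e^{−δ₀d(a,a′)}`, `N′ = 3·5^{d+1}e^{αδ₀(2L+6)}c₁(α)`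
(FILE 3-B's overlap count). [cite: Balaban1984PropagatorsII, p.232 («A summation preserves it also»), Lemma 2.1 (2.61) p.234, p.235] -/
theorem sum_transposedCommB_majorant_le (hι : ∀ s, β i.hN i.D i.hk (ιB s) = s) (d' : ℕ) {δ₀ α : ℝ} (hαδ : 0 ≤ α * δ₀)
    (h261 : Ineq261 d' (toB6 (geo9K i) Rr Hp) δ₀ α) {K : ℝ} (hK : 0 ≤ K) (a a' : IBondY i) :
    (∑ c : ↥(cubes i.D.toDomains),
        (if (∃ y ∈ QT i.D (B9GeoLemma21KLevelV1.one_le_Mh i) (four_le_P' i) c,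
            (((bondT i.D).dist (β i.hN i.D i.hk a) y : ℕ) : ℝ) ≤ 2 * (ℓ : ℝ) + 6)
          then K * ((geo9K i).len a * ((geo9K i).len a')⁻¹) * Real.exp (-(δ₀ * (geo9K i).dist a a')) else 0)) ≤
      (3 * 5 ^ (d + 1) * (Real.exp (α * δ₀ * (2 * (ℓ : ℝ) + 6)) * B6.c1 d' δ₀ α)) * K *
        (geo9K i).len a * ((geo9K i).len a')⁻¹ * Real.exp (-(δ₀ * (geo9K i).dist a a')) := by
  have hl := (B6KLevelCensusIndexV1.len_pos i a).le
  have hl' := inv_nonneg.2 (B6KLevelCensusIndexV1.len_pos i a').le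
  have hK0 : 0 ≤ K * ((geo9K i).len a * ((geo9K i).len a')⁻¹) * Real.exp (-(δ₀ * (geo9K i).dist a a')) := by positivity
  refine (sum_indicator_const_le i ιB hι d' hαδ h261 a hK0).trans (le_of_eq ?_)
  ring

omit [DecidableEq ι] in
/-- ★★ **THE FIRST FAMILY OF THE TRANSPOSED REMAINDER, SUMMED OVER THE COVER**: `Σ_□ conj b (h_□G_□(U)K(h_□)(U))` has the scale-weighted block majorant
`N′·M₂(Σ‖b_j‖)·θ_Tᴮ·L⁵·ℓ(a)·ℓ(a′)⁻¹·e^{−δ₀d(a,a′)}` — print's «K(h_□)G_□h_□ satisfies (3.89), hence it is small», read from the right and summed («A summation preserves it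
also»). [cite: Balaban1985BackgroundPropagators, p.414, p.415, (3.89) p.409; Balaban1984PropagatorsII, (2.51) p.232, Prop. 2.2 p.234, Lemma 2.1 (2.61) p.234] -/
theorem hasMajorant_sum_conj_transposedCommB (hι : ∀ s, β i.hN i.D i.hk (ιB s) = s)
    {M₂ : ℝ} (hM₂ : 0 ≤ M₂) (hrepr : ∀ (v : 𝔸) (j : ι), |b.repr v j| ≤ M₂ * ‖v‖) (hη : etaS i = |i.cf|⁻¹)
    (parS : SiteParY 𝔸 i) (parB : BondParY 𝔸 i) {B₀ δ₀ : ℝ} (hB₀ : 0 ≤ B₀) (hδ₀ : 0 ≤ δ₀)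
    (hE : ∀ c : ↥(cubes i.D.toDomains), EBlock (kernelFamilyBInv i B cfg (GACubeY i c parS parB) par) B₀ δ₀ U₁)
    (hU : ∀ μ x, ‖(cfg U₁ μ x : 𝔸)‖ ≤ 1 ∧ ‖(((cfg U₁ μ x)⁻¹ : 𝔸ˣ) : 𝔸)‖ ≤ 1)
    (hT : ∀ (y : IBondY i) (f : FBondY i), ‖(qT i parB (cfg U₁) y f : 𝔸)‖ ≤ 1 ∧ ‖(((qT i parB (cfg U₁) y f)⁻¹ : 𝔸ˣ) : 𝔸)‖ ≤ 1)
    {δh : ℝ} (hδh : 0 ≤ δh)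
    (hW : ∀ p : PlaqY i, ‖((holY i (cfg U₁) p : 𝔸ˣ) : 𝔸) - 1‖ ≤ δh * ((((ℓ : ℝ) + 1) ^ levY i (chartY i p.src))⁻¹) ^ 2)
    (T₂ : IBondY i → Finset (IBondY i)) (hT₂ : ∀ a y' : IBondY i, (geo9K i).dist a y' ≤ 2 → a ∈ T₂ y')
    {m₂ : ℝ} (hm₂ : 0 ≤ m₂) (hnbr₂ : ∀ y' : IBondY i, ((T₂ y').card : ℝ) ≤ m₂)
    (TQ : IBondY i → Finset (IBondY i)) (hTQ : ∀ a y' : IBondY i, (geo9K i).dist a y' ≤ 2 * (ℓ : ℝ) + 6 → a ∈ TQ y')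
    {mQ : ℝ} (hmQ : 0 ≤ mQ) (hnbrQ : ∀ y' : IBondY i, ((TQ y').card : ℝ) ≤ mQ)
    (d' : ℕ) {α : ℝ} (hαδ : 0 ≤ α * δ₀) (h261 : Ineq261 d' (toB6 (geo9K i) Rr Hp) δ₀ α) :
    HasMajorant (g := toB6 (geo9K i) Rr Hp) (fun p : FBondY i × ι => ιB (blkV1 i.hN i.D p.1))
      (∑ c : ↥(cubes i.D.toDomains),
        conj b ((cutMulY (hBdY i (hTY i c)) * GACubeY i c parS parB (cfg U₁) * KhBY i (hTY i c) parB (cfg U₁)).restrictScalars ℝ))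
      (fun a a' => (3 * 5 ^ (d + 1) * (Real.exp (α * δ₀ * (2 * (ℓ : ℝ) + 6)) * B6.c1 d' δ₀ α)) *
          (M₂ * (∑ j, ‖b j‖) *
            ((B₀ * (((d : ℝ) + 1) * m₂ * Real.exp (δ₀ * 2)
                * ((2 * ((d : ℝ) + 1) + 4) * (5 / 8 * C1F d ℓ / i.Mh) + (5 / 8) ^ 2 * (C2F d ℓ + 2 * C2X d ℓ) / (i.Mh : ℝ) ^ 2
                    + 8 * δh * ((ℓ : ℝ) + 1) ^ 5 * (5 / 8 * C1F d ℓ / i.Mh) + 64 * δh * ((ℓ : ℝ) + 1) ^ 7 * (5 / 8 * C1F d ℓ / i.Mh))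
              + mQ * Real.exp (δ₀ * (2 * (ℓ : ℝ) + 6))
                * (4 * b₁ * ((ℓ : ℝ) + 1) ^ 6 * (((ℓ : ℝ) + 1) ^ (d + 1)) ^ 5 * (sLipT d ℓ / (((ℓ : ℝ) + 1) * i.Mh) * (((ℓ : ℝ) + 1) + 3)))))
              * ((ℓ : ℝ) + 1) ^ 5)) *
        (geo9K i).len a * ((geo9K i).len a')⁻¹ * Real.exp (-(δ₀ * (geo9K i).dist a a'))) := by
  classical
  obtain ⟨_, hMh2, _, _⟩ := side_conditions i
  have hM : (0 : ℝ) < i.Mh := by exact_mod_cast (lt_of_lt_of_le (by norm_num) hMh2)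
  have hC1 : 0 ≤ C1F d ℓ := C1F_nonneg d ℓ
  have hC2 : 0 ≤ C2F d ℓ := C2F_nonneg d ℓ
  have hC2X : 0 ≤ C2X d ℓ := (C2X_bounds d ℓ).2.2
  have hsL : 0 ≤ sLipT d ℓ := sLipT_nonneg d ℓ
  have hSb : 0 ≤ ∑ j, ‖b j‖ := Finset.sum_nonneg fun _ _ => norm_nonneg _
  have hsum := B9Thm37Sum.hasMajorant_finsetSum (G := toB6 (geo9K i) Rr Hp) (fun p : FBondY i × ι => ιB (blkV1 i.hN i.D p.1))
    (Finset.univ : Finset ↥(cubes i.D.toDomains)) _ _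
    fun c _ => hasMajorant_conj_transposedCommB i b ιB cfg par (Rr := Rr) (Hp := Hp) hι hM₂ hrepr hη parS parB hB₀ hδ₀ c (hE c) hU hT hδh hW
      T₂ hT₂ hm₂ hnbr₂ TQ hTQ hmQ hnbrQ
  refine hasMajorant_mono (g := toB6 (geo9K i) Rr Hp) _ hsum fun a a' => ?_
  have hb1 : 0 ≤ b₁ := (b1_pos i a).le
  have hK0 : 0 ≤ M₂ * (∑ j, ‖b j‖) *
      ((B₀ * (((d : ℝ) + 1) * m₂ * Real.exp (δ₀ * 2)
          * ((2 * ((d : ℝ) + 1) + 4) * (5 / 8 * C1F d ℓ / i.Mh) + (5 / 8) ^ 2 * (C2F d ℓ + 2 * C2X d ℓ) / (i.Mh : ℝ) ^ 2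
              + 8 * δh * ((ℓ : ℝ) + 1) ^ 5 * (5 / 8 * C1F d ℓ / i.Mh) + 64 * δh * ((ℓ : ℝ) + 1) ^ 7 * (5 / 8 * C1F d ℓ / i.Mh))
        + mQ * Real.exp (δ₀ * (2 * (ℓ : ℝ) + 6))
          * (4 * b₁ * ((ℓ : ℝ) + 1) ^ 6 * (((ℓ : ℝ) + 1) ^ (d + 1)) ^ 5 * (sLipT d ℓ / (((ℓ : ℝ) + 1) * i.Mh) * (((ℓ : ℝ) + 1) + 3)))))
        * ((ℓ : ℝ) + 1) ^ 5) := by positivity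
  exact sum_transposedCommB_majorant_le i ιB hι d' hαδ h261 hK0 a a'

end Majorant

/-! ## §3 ★★★ Theorem 3.10 ⇒ the (3.42) block of `G(U)` at the cover of record, the first family of `hV` DISCHARGED -/

section Cubes

variable [Fintype (geo9K i).Site] [DecidableEq (geo9K i).Site] {Rr : ℝ} {Hp : Prop}
variable (ιB : BlkY i → IBondY i)
variable {B : B9.Backgrounds} (cfg : B.Cfg → CfgY 𝔸 i) (par : BondParY 𝔸 i) {U₁ : B.Cfg}

omit [Fintype ι] [DecidableEq ι] [Fintype (geo9K i).Site] [DecidableEq (geo9K i).Site] in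
/-- a linear map with a majorant keeps it under negation (bookkeeping). [cite: Balaban1984PropagatorsII, (2.51) p.232, bookkeeping] -/
private theorem hasMajorant_neg' {g : B6.Geometry} {X : Type} (blk : X → g.Site) {T : Module.End ℝ (X → ℝ)} {K : g.Site → g.Site → ℝ}
    (h : HasMajorant (g := g) blk T K) : HasMajorant (g := g) blk (-T) K := by
  intro y' μ Bμ hμ x
  rw [LinearMap.neg_apply, Pi.neg_apply, abs_neg]
  exact h y' μ Bμ hμ x

/-- ★★★ **THEOREM 3.10 ⇒ THE (3.42) BLOCK OF `kernelFamilyBInv … (GAY i parS parB Gp) …` AT THE COVER OF RECORD, ALL CUT-OFF CUBE TERMS AND THE FIRST FAMILIES OF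
`R` AND OF THE TRANSPOSED REMAINDER DISCHARGED**: the 6-B plug-in `eBlock_kernelFamilyBInv_GAY_of_coverCubes` with its `hV` slot fed by §2's scale-weighted majorant of
`−Σ_□ conj b (h_□G_□K(h_□))` plus a displayed majorant `hV′` (`θ′_V·ℓ(a)ℓ(a′)⁻¹e^{−δ₀d}`) of families 2–4 (p. 415 ∕ (3.101): the walk re-expansion, PLAN items 6–7);
`θ_V := N′·M₂(Σ‖b_j‖)·θ_Tᴮ·L⁵ + θ′_V` with `θ_Tᴮ` of T2 at the counts `m₂ = e^{2αδ₀}c₁(α)`, `m_Q = e^{αδ₀(2L+6)}c₁(α)` of [4] (2.61).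
[cite: Balaban1985BackgroundPropagators, Thm 3.3 p.399 (3.42) p.397 via Thm 3.10 pp.414–416, p.414 («K(h_□)G_□h_□ … small»), p.415; Balaban1984PropagatorsII, Prop. 2.2 (2.67) p.234, Lemma 2.1 (2.61) p.234] -/
theorem eBlock_kernelFamilyBInv_GAY_of_coverCubes' (hι : ∀ s, β i.hN i.D i.hk (ιB s) = s)
    {M₂ : ℝ} (hM₂ : 0 ≤ M₂) (hrepr : ∀ (v : 𝔸) (j : ι), |b.repr v j| ≤ M₂ * ‖v‖) (hη : etaS i = |i.cf|⁻¹) (hb₁ : 0 ≤ b₁)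
    (parS : SiteParY 𝔸 i) (parB : BondParY 𝔸 i) (Gp : SiteOpY 𝔸 i)
    (ζ : ↥(cubes i.D.toDomains) → SiteY i → ℝ) (hζ : ∀ c z, hTY i c z ≠ 0 → ζ c z = 1)
    (hinvC : ∀ c : ↥(cubes i.D.toDomains), IsUnit (deltaACubeY i c parS parB (cfg U₁))) (hinvU : IsUnit (deltaAY i parS parB Gp (cfg U₁)))
    (D Ds : Fin (d + 1) → Module.End ℝ (FBondY i → 𝔸)) (hD : ∀ ν Λ, D ν Λ = cdB i (cfg U₁) ν Λ) (hDs : ∀ ν Λ, Ds ν Λ = cdsB i (cfg U₁) ν Λ)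
    (Lp : Module.End ℝ (FBondY i → 𝔸)) (hLp : ∀ Λ, Lp Λ = lapB i (cfg U₁) Λ)
    (d' : ℕ) {δ₀ α Θ' θV' B₀ δh : ℝ}
    (hB₀ : 0 ≤ B₀) (hδ₀ : 0 ≤ δ₀) (hΘ' : 0 ≤ Θ') (hθV' : 0 ≤ θV') (hδh : 0 ≤ δh)
    (hαδ : 0 ≤ α * δ₀) (hαδ2 : 0 ≤ (1 - 2 * α) * δ₀)
    (h261 : Ineq261 d' (toB6 (geo9K i) Rr Hp) δ₀ α) (h263 : Ineq263 d' (toB6 (geo9K i) Rr Hp) δ₀ α)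
    (hsmall : ((3 * 5 ^ (d + 1) * (Real.exp (α * δ₀ * (2 * (ℓ : ℝ) + 6)) * B6.c1 d' δ₀ α)) *
        (M₂ * (∑ j, ‖b j‖) * theta389B d ℓ B₀ b₁ δ₀ 1 (2 * δh) (δh * (((ℓ : ℝ) + 1) ^ 2 + 1)) δh 0 * ((geo9K i).M)⁻¹) + Θ') * B6.c1 d' δ₀ α < 1)
    (hsmallV : ((3 * 5 ^ (d + 1) * (Real.exp (α * δ₀ * (2 * (ℓ : ℝ) + 6)) * B6.c1 d' δ₀ α)) *
          (M₂ * (∑ j, ‖b j‖) *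
            ((B₀ * (((d : ℝ) + 1) * (Real.exp (α * δ₀ * 2) * B6.c1 d' δ₀ α) * Real.exp (δ₀ * 2)
                * ((2 * ((d : ℝ) + 1) + 4) * (5 / 8 * C1F d ℓ / i.Mh) + (5 / 8) ^ 2 * (C2F d ℓ + 2 * C2X d ℓ) / (i.Mh : ℝ) ^ 2
                    + 8 * δh * ((ℓ : ℝ) + 1) ^ 5 * (5 / 8 * C1F d ℓ / i.Mh) + 64 * δh * ((ℓ : ℝ) + 1) ^ 7 * (5 / 8 * C1F d ℓ / i.Mh))
              + (Real.exp (α * δ₀ * (2 * (ℓ : ℝ) + 6)) * B6.c1 d' δ₀ α) * Real.exp (δ₀ * (2 * (ℓ : ℝ) + 6))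
                * (4 * b₁ * ((ℓ : ℝ) + 1) ^ 6 * (((ℓ : ℝ) + 1) ^ (d + 1)) ^ 5 * (sLipT d ℓ / (((ℓ : ℝ) + 1) * i.Mh) * (((ℓ : ℝ) + 1) + 3)))))
              * ((ℓ : ℝ) + 1) ^ 5)) + θV') * B6.c1 d' δ₀ α < 1)
    (hE : ∀ c : ↥(cubes i.D.toDomains), EBlock (kernelFamilyBInv i B cfg (GACubeY i c parS parB) par) B₀ δ₀ U₁)
    (hU : ∀ μ x, ‖(cfg U₁ μ x : 𝔸)‖ ≤ 1 ∧ ‖(((cfg U₁ μ x)⁻¹ : 𝔸ˣ) : 𝔸)‖ ≤ 1)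
    (hT : ∀ (y : IBondY i) (f : FBondY i), ‖(qT i parB (cfg U₁) y f : 𝔸)‖ ≤ 1 ∧ ‖(((qT i parB (cfg U₁) y f)⁻¹ : 𝔸ˣ) : 𝔸)‖ ≤ 1)
    (hW : ∀ p : PlaqY i, ‖((holY i (cfg U₁) p : 𝔸ˣ) : 𝔸) - 1‖ ≤ δh * ((((ℓ : ℝ) + 1) ^ levY i (chartY i p.src))⁻¹) ^ 2)
    (hrest : HasMajorant (g := toB6 (geo9K i) Rr Hp) (fun p : FBondY i × ι => ιB (blkV1 i.hN i.D p.1))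
      (∑ c, conj b (((1 - cutMulY (hBdY i (ζ c))) * DPDsY i parS Gp (cfg U₁) *
            (cutMulY (hBdY i (hTY i c)) * GACubeY i c parS parB (cfg U₁) * cutMulY (hBdY i (hTY i c)))).restrictScalars ℝ)
        + ∑ c, conj b ((cutMulY (hBdY i (ζ c)) * (DPDsY i parS Gp (cfg U₁) - DPDsCubeY i c parS (cfg U₁)) *
            (cutMulY (hBdY i (hTY i c)) * GACubeY i c parS parB (cfg U₁) * cutMulY (hBdY i (hTY i c)))).restrictScalars ℝ)
        + ∑ c, conj b ((cutMulY (hBdY i (ζ c)) * P1CubeY i c (hTY i c) parS (cfg U₁) * GACubeY i c parS parB (cfg U₁) *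
            cutMulY (hBdY i (hTY i c))).restrictScalars ℝ))
      (fun a a' => Θ' * Real.exp (-(δ₀ * (geo9K i).dist a a'))))
    (hV' : HasMajorant (g := toB6 (geo9K i) Rr Hp) (fun p : FBondY i × ι => ιB (blkV1 i.hN i.D p.1))
      (-(∑ c, conj b ((cutMulY (hBdY i (hTY i c)) * GACubeY i c parS parB (cfg U₁) * P1CubeY i c (hTY i c) parS (cfg U₁)).restrictScalars ℝ))
        + ∑ c, conj b ((cutMulY (hBdY i (hTY i c)) * GACubeY i c parS parB (cfg U₁) * cutMulY (hBdY i (hTY i c)) *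
            (cutMulY (hBdY i (ζ c)) * (DPDsY i parS Gp (cfg U₁) - DPDsCubeY i c parS (cfg U₁)))).restrictScalars ℝ)
        + ∑ c, conj b ((cutMulY (hBdY i (hTY i c)) * GACubeY i c parS parB (cfg U₁) * cutMulY (hBdY i (hTY i c)) *
            ((1 - cutMulY (hBdY i (ζ c))) * DPDsY i parS Gp (cfg U₁))).restrictScalars ℝ))
      (fun a a' => θV' * (geo9K i).len a * ((geo9K i).len a')⁻¹ * Real.exp (-(δ₀ * (geo9K i).dist a a')))) :
    EBlock (kernelFamilyBInv i B cfg (GAY i parS parB Gp) par)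
      (M₂ * (∑ j, ‖b j‖) *
        ((3 * 5 ^ (d + 1)) * (M₂ * (∑ j, ‖b j‖) * B₀) * B6.c1 d' δ₀ α *
            (1 - ((3 * 5 ^ (d + 1) * (Real.exp (α * δ₀ * (2 * (ℓ : ℝ) + 6)) * B6.c1 d' δ₀ α)) *
              (M₂ * (∑ j, ‖b j‖) * theta389B d ℓ B₀ b₁ δ₀ 1 (2 * δh) (δh * (((ℓ : ℝ) + 1) ^ 2 + 1)) δh 0 * ((geo9K i).M)⁻¹) + Θ') *
              B6.c1 d' δ₀ α)⁻¹ +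
          ((3 * 5 ^ (d + 1) * (Real.exp (α * δ₀ * (2 * (ℓ : ℝ) + 6)) * B6.c1 d' δ₀ α)) *
              (M₂ * (∑ j, ‖b j‖) * (B₀ * (1 + 5 * C1F d ℓ * (((ℓ : ℝ) + 1) * Real.exp δ₀) / (8 * (i.Mh : ℝ)))))) * B6.c1 d' δ₀ α *
            (1 - ((3 * 5 ^ (d + 1) * (Real.exp (α * δ₀ * (2 * (ℓ : ℝ) + 6)) * B6.c1 d' δ₀ α)) *
              (M₂ * (∑ j, ‖b j‖) * theta389B d ℓ B₀ b₁ δ₀ 1 (2 * δh) (δh * (((ℓ : ℝ) + 1) ^ 2 + 1)) δh 0 * ((geo9K i).M)⁻¹) + Θ') *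
              B6.c1 d' δ₀ α)⁻¹ +
          ((3 * 5 ^ (d + 1) * (Real.exp (α * δ₀ * (2 * (ℓ : ℝ) + 6)) * B6.c1 d' δ₀ α)) *
              (M₂ * (∑ j, ‖b j‖) * (B₀ * (1 + Real.exp (α * δ₀) * B6.c1 d' δ₀ α * Real.exp δ₀ * (5 / 8 * C1F d ℓ / i.Mh))))) * B6.c1 d' δ₀ α *
            (1 - ((3 * 5 ^ (d + 1) * (Real.exp (α * δ₀ * (2 * (ℓ : ℝ) + 6)) * B6.c1 d' δ₀ α)) *
                (M₂ * (∑ j, ‖b j‖) *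
                  ((B₀ * (((d : ℝ) + 1) * (Real.exp (α * δ₀ * 2) * B6.c1 d' δ₀ α) * Real.exp (δ₀ * 2)
                      * ((2 * ((d : ℝ) + 1) + 4) * (5 / 8 * C1F d ℓ / i.Mh) + (5 / 8) ^ 2 * (C2F d ℓ + 2 * C2X d ℓ) / (i.Mh : ℝ) ^ 2
                          + 8 * δh * ((ℓ : ℝ) + 1) ^ 5 * (5 / 8 * C1F d ℓ / i.Mh) + 64 * δh * ((ℓ : ℝ) + 1) ^ 7 * (5 / 8 * C1F d ℓ / i.Mh))
                    + (Real.exp (α * δ₀ * (2 * (ℓ : ℝ) + 6)) * B6.c1 d' δ₀ α) * Real.exp (δ₀ * (2 * (ℓ : ℝ) + 6))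
                      * (4 * b₁ * ((ℓ : ℝ) + 1) ^ 6 * (((ℓ : ℝ) + 1) ^ (d + 1)) ^ 5 * (sLipT d ℓ / (((ℓ : ℝ) + 1) * i.Mh) * (((ℓ : ℝ) + 1) + 3)))))
                    * ((ℓ : ℝ) + 1) ^ 5)) + θV') * B6.c1 d' δ₀ α)⁻¹ +
          ((3 * 5 ^ (d + 1) * (Real.exp (α * δ₀ * (2 * (ℓ : ℝ) + 6)) * B6.c1 d' δ₀ α)) *
              (M₂ * (∑ j, ‖b j‖) * (B₀ * (1 + ((d : ℝ) + 1) * (5 / 8 * C1F d ℓ / i.Mh * (Real.exp δ₀ + 1) + 25 / 64 * C2F d ℓ / i.Mh ^ 2))))) * B6.c1 d' δ₀ α *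
            (1 - ((3 * 5 ^ (d + 1) * (Real.exp (α * δ₀ * (2 * (ℓ : ℝ) + 6)) * B6.c1 d' δ₀ α)) *
              (M₂ * (∑ j, ‖b j‖) * theta389B d ℓ B₀ b₁ δ₀ 1 (2 * δh) (δh * (((ℓ : ℝ) + 1) ^ 2 + 1)) δh 0 * ((geo9K i).M)⁻¹) + Θ') *
              B6.c1 d' δ₀ α)⁻¹))
      ((1 - 2 * α) * δ₀) U₁ := by
  classical
  obtain ⟨_, hMh2, _, _⟩ := side_conditions i
  have hM : (0 : ℝ) < i.Mh := by exact_mod_cast (lt_of_lt_of_le (by norm_num) hMh2)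
  have hC1 : 0 ≤ C1F d ℓ := C1F_nonneg d ℓ
  have hC2 : 0 ≤ C2F d ℓ := C2F_nonneg d ℓ
  have hC2X : 0 ≤ C2X d ℓ := (C2X_bounds d ℓ).2.2
  have hsL : 0 ≤ sLipT d ℓ := sLipT_nonneg d ℓ
  have hSb : 0 ≤ ∑ j, ‖b j‖ := Finset.sum_nonneg fun _ _ => norm_nonneg _
  have hc1 : 0 ≤ B6.c1 d' δ₀ α := c1_nonneg d' δ₀ α
  -- the two neighbourhood counts of T2 from (2.61)
  have hm₂ : 0 ≤ Real.exp (α * δ₀ * 2) * B6.c1 d' δ₀ α := by positivity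
  have hmQ : 0 ≤ Real.exp (α * δ₀ * (2 * (ℓ : ℝ) + 6)) * B6.c1 d' δ₀ α := by positivity
  have hnbr₂ : ∀ y' : IBondY i, ((((Finset.univ : Finset ((geo9K i).Site)).filter fun a => (geo9K i).dist a y' ≤ 2).card : ℕ) : ℝ) ≤
      Real.exp (α * δ₀ * 2) * B6.c1 d' δ₀ α := fun y' => card_ball_le_of_ineq261 i d' hαδ h261 2 y'
  have hnbrQ : ∀ y' : IBondY i, ((((Finset.univ : Finset ((geo9K i).Site)).filter fun a => (geo9K i).dist a y' ≤ 2 * (ℓ : ℝ) + 6).card : ℕ) : ℝ) ≤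
      Real.exp (α * δ₀ * (2 * (ℓ : ℝ) + 6)) * B6.c1 d' δ₀ α := fun y' => card_ball_le_of_ineq261 i d' hαδ h261 _ y'
  -- the first family of the transposed remainder (§2)
  set θ₁ : ℝ := (3 * 5 ^ (d + 1) * (Real.exp (α * δ₀ * (2 * (ℓ : ℝ) + 6)) * B6.c1 d' δ₀ α)) *
      (M₂ * (∑ j, ‖b j‖) *
        ((B₀ * (((d : ℝ) + 1) * (Real.exp (α * δ₀ * 2) * B6.c1 d' δ₀ α) * Real.exp (δ₀ * 2)
            * ((2 * ((d : ℝ) + 1) + 4) * (5 / 8 * C1F d ℓ / i.Mh) + (5 / 8) ^ 2 * (C2F d ℓ + 2 * C2X d ℓ) / (i.Mh : ℝ) ^ 2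
                + 8 * δh * ((ℓ : ℝ) + 1) ^ 5 * (5 / 8 * C1F d ℓ / i.Mh) + 64 * δh * ((ℓ : ℝ) + 1) ^ 7 * (5 / 8 * C1F d ℓ / i.Mh))
          + (Real.exp (α * δ₀ * (2 * (ℓ : ℝ) + 6)) * B6.c1 d' δ₀ α) * Real.exp (δ₀ * (2 * (ℓ : ℝ) + 6))
            * (4 * b₁ * ((ℓ : ℝ) + 1) ^ 6 * (((ℓ : ℝ) + 1) ^ (d + 1)) ^ 5 * (sLipT d ℓ / (((ℓ : ℝ) + 1) * i.Mh) * (((ℓ : ℝ) + 1) + 3)))))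
          * ((ℓ : ℝ) + 1) ^ 5)) with hθ₁
  have hθ₁0 : 0 ≤ θ₁ := by positivity
  have h1 := hasMajorant_sum_conj_transposedCommB i b ιB cfg par (Rr := Rr) (Hp := Hp) hι hM₂ hrepr hη parS parB hB₀ hδ₀ hE hU hT hδh hW
    (fun y' : IBondY i => ((Finset.univ : Finset ((geo9K i).Site)).filter fun a => (geo9K i).dist a y' ≤ 2))
    (fun a y' h => Finset.mem_filter.2 ⟨Finset.mem_univ (α := (geo9K i).Site) a, h⟩) hm₂ hnbr₂
    (fun y' : IBondY i => ((Finset.univ : Finset ((geo9K i).Site)).filter fun a => (geo9K i).dist a y' ≤ 2 * (ℓ : ℝ) + 6))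
    (fun a y' h => Finset.mem_filter.2 ⟨Finset.mem_univ (α := (geo9K i).Site) a, h⟩) hmQ hnbrQ d' hαδ h261
  -- the four families together: `θ_V = θ₁ + θ′_V`
  have hV : HasMajorant (g := toB6 (geo9K i) Rr Hp) (fun p : FBondY i × ι => ιB (blkV1 i.hN i.D p.1))
      (-(∑ c, conj b ((cutMulY (hBdY i (hTY i c)) * GACubeY i c parS parB (cfg U₁) * KhBY i (hTY i c) parB (cfg U₁)).restrictScalars ℝ))
        - ∑ c, conj b ((cutMulY (hBdY i (hTY i c)) * GACubeY i c parS parB (cfg U₁) * P1CubeY i c (hTY i c) parS (cfg U₁)).restrictScalars ℝ)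
        + ∑ c, conj b ((cutMulY (hBdY i (hTY i c)) * GACubeY i c parS parB (cfg U₁) * cutMulY (hBdY i (hTY i c)) *
            (cutMulY (hBdY i (ζ c)) * (DPDsY i parS Gp (cfg U₁) - DPDsCubeY i c parS (cfg U₁)))).restrictScalars ℝ)
        + ∑ c, conj b ((cutMulY (hBdY i (hTY i c)) * GACubeY i c parS parB (cfg U₁) * cutMulY (hBdY i (hTY i c)) *
            ((1 - cutMulY (hBdY i (ζ c))) * DPDsY i parS Gp (cfg U₁))).restrictScalars ℝ))
      (fun a a' => (θ₁ + θV') * (geo9K i).len a * ((geo9K i).len a')⁻¹ * Real.exp (-(δ₀ * (geo9K i).dist a a'))) := by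
    have e : (-(∑ c, conj b ((cutMulY (hBdY i (hTY i c)) * GACubeY i c parS parB (cfg U₁) * KhBY i (hTY i c) parB (cfg U₁)).restrictScalars ℝ))
        - ∑ c, conj b ((cutMulY (hBdY i (hTY i c)) * GACubeY i c parS parB (cfg U₁) * P1CubeY i c (hTY i c) parS (cfg U₁)).restrictScalars ℝ)
        + ∑ c, conj b ((cutMulY (hBdY i (hTY i c)) * GACubeY i c parS parB (cfg U₁) * cutMulY (hBdY i (hTY i c)) *
            (cutMulY (hBdY i (ζ c)) * (DPDsY i parS Gp (cfg U₁) - DPDsCubeY i c parS (cfg U₁)))).restrictScalars ℝ)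
        + ∑ c, conj b ((cutMulY (hBdY i (hTY i c)) * GACubeY i c parS parB (cfg U₁) * cutMulY (hBdY i (hTY i c)) *
            ((1 - cutMulY (hBdY i (ζ c))) * DPDsY i parS Gp (cfg U₁))).restrictScalars ℝ))
        = (-(∑ c, conj b ((cutMulY (hBdY i (hTY i c)) * GACubeY i c parS parB (cfg U₁) * KhBY i (hTY i c) parB (cfg U₁)).restrictScalars ℝ)))
          + ((-(∑ c, conj b ((cutMulY (hBdY i (hTY i c)) * GACubeY i c parS parB (cfg U₁) * P1CubeY i c (hTY i c) parS (cfg U₁)).restrictScalars ℝ)))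
            + ∑ c, conj b ((cutMulY (hBdY i (hTY i c)) * GACubeY i c parS parB (cfg U₁) * cutMulY (hBdY i (hTY i c)) *
                (cutMulY (hBdY i (ζ c)) * (DPDsY i parS Gp (cfg U₁) - DPDsCubeY i c parS (cfg U₁)))).restrictScalars ℝ)
            + ∑ c, conj b ((cutMulY (hBdY i (hTY i c)) * GACubeY i c parS parB (cfg U₁) * cutMulY (hBdY i (hTY i c)) *
                ((1 - cutMulY (hBdY i (ζ c))) * DPDsY i parS Gp (cfg U₁))).restrictScalars ℝ)) := by
      abel
    rw [e]
    refine hasMajorant_mono (g := toB6 (geo9K i) Rr Hp) _ (hasMajorant_add _ (hasMajorant_neg' _ h1) hV') fun a a' => le_of_eq ?_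
    rw [hθ₁]; ring
  have hθV : 0 ≤ θ₁ + θV' := add_nonneg hθ₁0 hθV'
  have hsmallV' : (θ₁ + θV') * B6.c1 d' δ₀ α < 1 := by rw [hθ₁]; exact hsmallV
  exact eBlock_kernelFamilyBInv_GAY_of_coverCubes i b ιB cfg par hι hM₂ hrepr hη hb₁ parS parB Gp ζ hζ hinvC hinvU D Ds hD hDs Lp hLp d'
    hB₀ hδ₀ hΘ' hθV hδh hαδ hαδ2 h261 h263 hsmall hsmallV' hE hU hT hW hrest hV

end Cubes

end Literature.MathematicalPhysics.QuantumFieldTheory.Balaban1983to89.B9Thm310TransposedCommutatorBMajorant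

end
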